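import Mathlib.Analysis.SpecialFunctions.SmoothTransition
import Mathlib.Analysis.Calculus.FDeriv.Pow
import Literature.Analysis.FluidPDE.SereginZajaczkowski2007L6
import Literature.Analysis.FluidPDE.CKNTenThirdsInterpolation
import HarnessLib

/-!
# Seregin–Zajaczkowski 2007, Lemma 4.3: the swirl `L⁶` bound from (4.17) and (4.18)

G. Seregin, W. Zajaczkowski, *A sufficient condition of regularity for axially symmetric
solutions to the Navier–Stokes equations*, SIAM J. Math. Anal. 39 (2007) 669–685 =
arXiv:math/0702720 (numbers below are those of the arXiv version, §4). The sibling file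
`SereginZajaczkowski2007L6.lean` vendors Lemma 4.3 as the named fact `OffAxisSwirlL6Bound`:

> **Lemma 4.3.** Under assumptions of Proposition 4.1, there exists a non decreasing function
> `Φ₅ : ℝ₊ → ℝ₊` such that `∫_{Q̃₂} |V_φ|⁶ dz ≤ Φ₅(𝒜₂)` (4.14), where `Q̃₂ = 𝒞̃₂ × ]-(3/2)², 0[` and
> `𝒞̃₂ = 𝒞(3/8, 5/2; 3/2)`.

Its printed proof: `V_φ` satisfies the swirl equation (4.15); for "a non-negative smooth and
axially symmetric cut-off function `ψ` vanishing in a neighborhood of the parabolic boundary of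
`Q̃₁` and being equal to `1` in `Q̃₂`" and `α̃ = V_φ ψ ϱ` (`α = V_φ ϱ`) one has an identity for `α̃`;
multiplying it by `α̃|α̃|²` and integrating by parts over `𝒞̃₁` gives the `L⁴`-energy identity
(4.16) `¼ ∂_t ∫_{𝒞̃₁} |α̃|⁴ dx + ¾ ∫_{𝒞̃₁} |∇_a(|α̃|²)|² dx = J₁ + J₂`; with `β̃ = |α̃|²` and the
multiplicative inequality

> `∫_{𝒞̃₁} |β̃|^{10/3} dx ≤ c (∫_{𝒞̃₁} |β̃|² dx)^{2/3} ∫_{𝒞̃₁} |∇β̃|² dx`                     (4.17)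

the terms `J₁`, `J₂` are estimated by Hölder's inequality (`𝒜₃ = ‖V^a‖_{L_{4,∞}(Q̃₁)}`), and Young's
inequality gives a differential inequality which, "together with the statement of Lemma 4.2 at
`q = 4`, implies

> `sup_{-(7/4)² ≤ t ≤ 0} ∫_{𝒞̃₁} |β̃(x,t)|² dx + ∫_{Q̃₁} |∇β̃|² dz ≤ Φ₅(𝒜₂)`.                  (4.18)

So, (4.14) follows from (4.17) and (4.18). Lemma 4.3 is proved."

This file and its companion `SereginZajaczkowski2007SwirlProofs.lean` formalise the LAST step
and its two inputs:

* **(4.17) is proved** here (`lintegral_rpow_tenThirds_le_of_contDiff`): for real `C¹_c`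
  functions `β` on `ℝ³`, `∫ |β|^{10/3} ≤ c (∫ β²)^{2/3} ∫ ‖Dβ‖²`, `c` the square of Mathlib's
  Gagliardo–Nirenberg–Sobolev constant (`p = 2`, `n = 3`): Lebesgue interpolation
  `∫ f^{10/3} ≤ (∫ f²)^{2/3} (∫ f⁶)^{1/3}` (accepted `lintegral_rpow_tenThirds_le_Lp_interpolation`)
  and `‖β‖₆ ≤ C ‖Dβ‖₂` (Mathlib's `MeasureTheory.eLpNorm_le_eLpNorm_fderiv_of_eq_inner`).
* **(4.18) is vendored here as the named fact `SwirlL4EnergyBound`** — the `L⁴`-energy bound for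
  `β̃ = |ϱ V_φ ψ|²`, i.e. the part of the proof carrying the PDE content ((4.15), (4.16), Hölder,
  Young, Gronwall and Lemma 4.2 at `q = 4`) — for every cut-off `ψ` of the printed kind
  (`IsSwirlCutoff ψ`, non-vacuous: the model cut-off `psi0`, `isSwirlCutoff_psi0`).
* **Lemma 4.3 is proved from them** in the companion file
  (`offAxisSwirlL6Bound_of_swirlL4EnergyBound : SwirlL4EnergyBound → OffAxisSwirlL6Bound`): fix
  the model cut-off `ψ₀`; for each `t ∈ ]-(7/4)², 0[` the slice `β̃(t, ·)` is `C¹` with compact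
  support in `𝒞̃₁`, so (4.17) applies on `𝒞̃₁`; the sup part of (4.18) bounds
  `(∫_{𝒞̃₁} β̃²)^{2/3} ≤ Φ₅^{2/3}`; integrating in `t` (Tonelli, the gradient integrand being
  continuous on `Q̃₁`) and the gradient part of (4.18) give `∫_{Q̃₁} β̃^{10/3} dz ≤ c Φ₅^{2/3} Φ₅`;
  on `Q̃₂ ⊆ Q̃₁`, `ψ₀ = 1` and `ϱ > 3/8`, so `|V_φ|⁶ = |α̃|⁶/ϱ⁶ ≤ (8/3)⁶ β̃³ ≤ (8/3)⁶ (1 + β̃^{10/3})`,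
  whence `∫_{Q̃₂} |V_φ|⁶ dz ≤ (8/3)⁶ (|Q̃₂| + c Φ₅(K)^{2/3} Φ₅(K))`, non-decreasing in `K ≥ 𝒜₂`.

## Rendering choices

* `α = ϱ V_φ` is the accepted junk-free `swirl (V t) x = x₀ V₁ - x₁ V₀` (`= cylRadius x *
  swirlVelocity (V t) x` off the axis, accepted `swirl_eq_cylRadius_mul_swirlVelocity`; both vanish
  on the axis), so `α̃ = alphaTilde ψ V t x = ψ(t, x) · swirl (V t) x` and
  `β̃ = betaTilde ψ V t x = α̃²` need no side condition.
* The cut-off class `IsSwirlCutoff ψ` (functions of `(t, x) ∈ ℝ × ℝ³`): `C^∞`; `ψ ≥ 0`;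
  `ψ(t, R_θ x) = ψ(t, x)`; `ψ = 1` on `Q̃₂`; "vanishing in a neighborhood of the parabolic
  boundary of `Q̃₁`" as (lateral part) the spatial support lies, for all times, in one compact
  subset of the open shell `𝒞̃₁`, and (bottom part) `ψ(t, ·) = 0` for `t ≤ t₀`, some
  `t₀ > -(7/4)²`. The printed argument is for an arbitrary fixed cut-off of this kind, the
  function `Φ₅` depending on it; accordingly `SwirlL4EnergyBound` reads "for every such `ψ` there
  is a monotone `Φ₅`" (chosen before the solution, fed an upper bound `K ≥ 𝒜₂`, as in the sibling
  facts; hypotheses `IsSmoothAxisymmetricSolutionOn Q̃ V P`, `𝒜₂ = SereginSverak2009.szEnergy`).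
* (4.18): the `sup` over `-(7/4)² ≤ t ≤ 0` is rendered as `⨆` over the open interval
  `]-(7/4)², 0[` on which the class controls `V` (a conclusion weaker than or equal to the
  printed one); `|∇β̃|` is the norm of the spatial Fréchet derivative `fderiv ℝ (β̃ t) x` (for the
  axially symmetric `β̃` this is `|∇_a β̃|`); `𝒞̃₁ = shell (5/16) (11/4) (7/4)`,
  `Q̃₁ = shellCyl (5/16) (11/4) (7/4) (7/4)`, `Q̃₂ = shellCyl (3/8) (5/2) (3/2) (3/2)` (accepted).
* The final `Φ` of Lemma 4.3 is `K ↦ (8/3)⁶ (|Q̃₂| + c Φ₅(K)^{2/3} Φ₅(K))` (the passage from the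
  exponent `20/3` of `α̃` to `6` costs the measure of `Q̃₂`).

## Contents

* `gnTenThirdsConst`, `lintegral_rpow_tenThirds_le_of_contDiff` ((4.17), proved);
* `alphaTilde`, `betaTilde`, `IsSwirlCutoff`, the named fact `SwirlL4EnergyBound` ((4.18));
* the model cut-off `psi0 = cutT(t) cutR(ϱ²) cutZ(x₃)` and `isSwirlCutoff_psi0` (non-vacuity);
* explicit spatial derivatives: `swirlFDeriv` with `hasFDerivAt_swirl` (chain rule for
  `Γ = x₀ u₁ - x₁ u₀`), `sliceFDeriv` with `hasFDerivAt_slice`, and `betaTildeFDeriv` (the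
  derivative of `β̃(t, ·)`, established in the companion file).

## Not here

The proof of Lemma 4.3 from these inputs (companion file
`SereginZajaczkowski2007SwirlProofs.lean`). The discharge of `SwirlL4EnergyBound` itself: the
swirl equation (4.15) for the class (classical time derivative of `V_φ` from the distributional
Navier–Stokes system and the symmetry of `P`), the `L⁴`-energy identity (4.16), the Hölder–Young
bookkeeping of arXiv p. 6, Gronwall, and Lemma 4.2 (the sibling named fact `OffAxisPoloidalBound`).

## References

* G. Seregin, W. Zajaczkowski, SIAM J. Math. Anal. 39 (2007) 669–685, arXiv:math/0702720, §4:
  Prop. 4.1 (hypotheses, `𝒜₂`), Lemma 4.2, Lemma 4.3 ((4.14)) and its proof: (4.15), the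
  cut-off `ψ`, `α̃`, `β̃`, (4.16), (4.17), (4.18), and the sentence "So, (4.14) follows from (4.17)
  and (4.18)". [`SereginZajaczkowski2007`]
* L. C. Evans, *Partial Differential Equations*, 2nd ed. (2010), §5.6.1 Thm. 1
  (Gagliardo–Nirenberg–Sobolev inequality behind (4.17)).
-/

noncomputable section

open MeasureTheory Set Function Filter Topology TopologicalSpace Metric WithLp Module
open scoped NNReal ENNReal ContDiff InnerProductSpace RealInnerProductSpace

namespace Literature.Analysis.FluidPDE

namespace SereginZajaczkowski2007

open SereginSverak2009

/-- Local notation for physical space `ℝ³ = EuclideanSpace ℝ (Fin 3)`. -/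
local notation "ℝ³" => EuclideanSpace ℝ (Fin 3)

/-! ### (4.17): the multiplicative inequality on `ℝ³` -/

/-- The constant of (4.17): the square of Mathlib's Gagliardo–Nirenberg–Sobolev constant
(`p = 2`, `n = 3`, `p* = 6`). [folklore] -/
def gnTenThirdsConst : ℝ≥0 :=
  eLpNormLESNormFDerivOfEqInnerConst (volume : Measure ℝ³) 2 ^ 2

/-- **The multiplicative inequality (4.17)** `∫ |β|^{10/3} dx ≤ c (∫ |β|² dx)^{2/3} ∫ |∇β|² dx`
for real `C¹_c` functions on `ℝ³` (Gagliardo–Nirenberg: `‖β‖_{10/3} ≤ ‖β‖₂^{2/5} ‖β‖₆^{3/5}`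
and the Sobolev inequality `‖β‖₆ ≤ C ‖∇β‖₂`), in `[0, ∞]`-valued form.
[cite: SereginZajaczkowski2007, proof of Lemma 4.3, (4.17)] -/
theorem lintegral_rpow_tenThirds_le_of_contDiff {g : ℝ³ → ℝ} (hg : ContDiff ℝ 1 g)
    (hgc : HasCompactSupport g) :
    ∫⁻ x, ‖g x‖ₑ ^ (10 / 3 : ℝ) ≤
      gnTenThirdsConst * ((∫⁻ x, ‖g x‖ₑ ^ 2) ^ (2 / 3 : ℝ) * ∫⁻ x, ‖fderiv ℝ g x‖ₑ ^ 2) := by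
  have hmeas : AEMeasurable (fun x => ‖g x‖ₑ) (volume : Measure ℝ³) :=
    hg.continuous.aemeasurable.enorm
  have h1 := lintegral_rpow_tenThirds_le_Lp_interpolation (volume : Measure ℝ³) hmeas
  have h2 := eLpNorm_le_eLpNorm_fderiv_of_eq_inner (μ := (volume : Measure ℝ³)) hg hgc
    (p := 2) (p' := 6) (by norm_num) (by rw [finrank_euclideanSpace_fin]; norm_num)
    (by rw [finrank_euclideanSpace_fin]; norm_num)
  have hC : eLpNormLESNormFDerivOfEqInnerConst (volume : Measure ℝ³) ((2 : ℝ≥0) : ℝ) =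
      eLpNormLESNormFDerivOfEqInnerConst (volume : Measure ℝ³) 2 := by
    rw [NNReal.coe_ofNat]
  rw [hC, eLpNorm_nnreal_eq_lintegral (by norm_num), eLpNorm_nnreal_eq_lintegral (by norm_num),
    show ((2 : ℝ≥0) : ℝ) = 2 by norm_num, show ((6 : ℝ≥0) : ℝ) = 6 by norm_num] at h2
  have h3 : (∫⁻ x, ‖g x‖ₑ ^ (6 : ℝ)) ^ (1 / 3 : ℝ) ≤
      gnTenThirdsConst * ∫⁻ x, ‖fderiv ℝ g x‖ₑ ^ 2 := by
    have h4 := ENNReal.rpow_le_rpow h2 (z := 2) (by norm_num)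
    rw [← ENNReal.rpow_mul, ENNReal.mul_rpow_of_nonneg _ _ (by norm_num), ← ENNReal.rpow_mul,
      show (1 / 6 : ℝ) * 2 = 1 / 3 by norm_num, show (1 / (2 : ℝ)) * 2 = 1 by norm_num,
      ENNReal.rpow_one] at h4
    refine h4.trans (le_of_eq ?_)
    rw [gnTenThirdsConst, ENNReal.coe_pow, ENNReal.rpow_two]
    congr 1
    exact lintegral_congr fun x => by rw [ENNReal.rpow_two]
  calc ∫⁻ x, ‖g x‖ₑ ^ (10 / 3 : ℝ)
      ≤ (∫⁻ x, ‖g x‖ₑ ^ (2 : ℕ)) ^ (2 / 3 : ℝ) * (∫⁻ x, ‖g x‖ₑ ^ (6 : ℝ)) ^ (1 / 3 : ℝ) := h1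
    _ ≤ (∫⁻ x, ‖g x‖ₑ ^ (2 : ℕ)) ^ (2 / 3 : ℝ) * (gnTenThirdsConst * ∫⁻ x, ‖fderiv ℝ g x‖ₑ ^ 2) := by
        gcongr
    _ = gnTenThirdsConst * ((∫⁻ x, ‖g x‖ₑ ^ 2) ^ (2 / 3 : ℝ) * ∫⁻ x, ‖fderiv ℝ g x‖ₑ ^ 2) := by
        ring

/-! ### The cut-off functions of the proof of Lemma 4.3 and the quantities `α̃`, `β̃` -/

/-- `α̃ = V_φ ψ ϱ = ψ · (ϱ V_φ)` (Seregin–Zajaczkowski 2007, proof of Lemma 4.3: "`α̃ = V_φ ψ ϱ`",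
"`α = V_φ ϱ`"), with `ϱ V_φ` the accepted junk-free `swirl (V t) x = x₀ V₁ - x₁ V₀`
(`= cylRadius x * swirlVelocity (V t) x` off the axis, `swirl_eq_cylRadius_mul_swirlVelocity`).
[cite: SereginZajaczkowski2007, proof of Lemma 4.3 (definition of α̃)] -/
def alphaTilde (ψ : ℝ × ℝ³ → ℝ) (V : ℝ → ℝ³ → ℝ³) (t : ℝ) (x : ℝ³) : ℝ :=
  ψ (t, x) * swirl (V t) x

/-- `β̃ = |α̃|²` (Seregin–Zajaczkowski 2007, proof of Lemma 4.3: "We let `β̃ = |α̃|²`").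
[cite: SereginZajaczkowski2007, proof of Lemma 4.3 (definition of β̃)] -/
def betaTilde (ψ : ℝ × ℝ³ → ℝ) (V : ℝ → ℝ³ → ℝ³) (t : ℝ) (x : ℝ³) : ℝ :=
  alphaTilde ψ V t x ^ 2

/-- `β̃ ≥ 0`. [folklore] -/
theorem betaTilde_nonneg (ψ : ℝ × ℝ³ → ℝ) (V : ℝ → ℝ³ → ℝ³) (t : ℝ) (x : ℝ³) :
    0 ≤ betaTilde ψ V t x :=
  sq_nonneg _

/-- **The cut-off functions of the proof of Lemma 4.3**: "a non-negative smooth and axially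
symmetric cut-off function `ψ` vanishing in a neighborhood of the parabolic boundary of `Q̃₁` and
being equal to `1` in `Q̃₂`" (`Q̃₁ = 𝒞̃₁ × ]-(7/4)², 0[`, `𝒞̃₁ = 𝒞(5/16, 11/4; 7/4)`,
`Q̃₂ = 𝒞(3/8, 5/2; 3/2) × ]-(3/2)², 0[`). Rendered for a function `ψ` of `(t, x) ∈ ℝ × ℝ³`:
`C^∞` jointly; `ψ ≥ 0`; `ψ(t, R_θ x) = ψ(t, x)` for the rotations `R_θ` about the axis; `ψ = 1` on
`Q̃₂`; and "vanishing in a neighborhood of the parabolic boundary of `Q̃₁`" as: the spatial support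
lies, uniformly in time, in a fixed compact subset of the open shell `𝒞̃₁` (lateral part), and
`ψ(t, ·) = 0` for all `t ≤ t₀`, for some `t₀ > -(7/4)²` (bottom part).
[cite: SereginZajaczkowski2007, proof of Lemma 4.3 (the cut-off ψ)] -/
structure IsSwirlCutoff (ψ : ℝ × ℝ³ → ℝ) : Prop where
  /-- `ψ` is smooth in space–time. -/
  contDiff : ContDiff ℝ ∞ ψ
  /-- `ψ ≥ 0`. -/
  nonneg : ∀ z, 0 ≤ ψ z
  /-- `ψ` is axially symmetric. -/
  axisymmetric : ∀ (θ t : ℝ) (x : ℝ³), ψ (t, rotZ θ x) = ψ (t, x)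
  /-- `ψ = 1` on `Q̃₂ = 𝒞(3/8, 5/2; 3/2) × ]-(3/2)², 0[`. -/
  eq_one : ∀ z ∈ shellCyl (3 / 8) (5 / 2) (3 / 2) (3 / 2), ψ z = 1
  /-- `ψ` vanishes near the lateral boundary of `Q̃₁`: its spatial support lies in a fixed compact
  subset of the open shell `𝒞̃₁ = 𝒞(5/16, 11/4; 7/4)`. -/
  space_support : ∃ C : Set ℝ³, IsCompact C ∧ C ⊆ shell (5 / 16) (11 / 4) (7 / 4) ∧
    ∀ (t : ℝ) (x : ℝ³), x ∉ C → ψ (t, x) = 0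
  /-- `ψ` vanishes near the bottom `t = -(7/4)²` of `Q̃₁`. -/
  time_support : ∃ t₀ : ℝ, -(7 / 4 : ℝ) ^ 2 < t₀ ∧ ∀ t ≤ t₀, ∀ x : ℝ³, ψ (t, x) = 0

/-! ### (4.18) as a named fact -/

/-- **Seregin–Zajaczkowski 2007, proof of Lemma 4.3, estimate (4.18).** Under the assumptions of
Prop. 4.1 ("`V` and `P` [are] a sufficiently smooth axially symmetric solution to the Navier–Stokes
equations in `Q̃ = 𝒞(1/4, 3; 2) × ]-2², 0[`"), for the cut-off `ψ` fixed in the proof ("a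
non-negative smooth and axially symmetric cut-off function `ψ` vanishing in a neighborhood of the
parabolic boundary of `Q̃₁` and being equal to `1` in `Q̃₂`") and `α̃ = V_φ ψ ϱ`, `β̃ = |α̃|²`:
"`sup_{-(7/4)² ≤ t ≤ 0} ∫_{𝒞̃₁} |β̃(x,t)|² dx + ∫_{Q̃₁} |∇β̃|² dz ≤ Φ₅(𝒜₂)`" (4.18), `Φ₅`
non-decreasing (printed derivation: the swirl equation (4.15), the identity for `α̃`, the
`L⁴`-energy identity (4.16), the multiplicative inequality (4.17), Hölder's inequality with
`𝒜₃ = ‖V^a‖_{L_{4,∞}(Q̃₁)}`, Young's inequality, and "the statement of Lemma 4.2 at `q = 4`").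
Rendered (module docstring): for EVERY cut-off of the printed kind (`IsSwirlCutoff ψ`; the
printed argument is for an arbitrary fixed one, `Φ₅` depending on it) there is a monotone
`Φ₅ : ℝ≥0 → ℝ≥0`, chosen before the solution and fed an upper bound `K ≥ 𝒜₂`
(`𝒜₂ = SereginSverak2009.szEnergy V P (D_x V)`, hypotheses `IsSmoothAxisymmetricSolutionOn Q̃ V P`,
as for the sibling facts), such that the supremum over the open time interval `]-(7/4)², 0[` of
`∫_{𝒞̃₁} β̃² dx` plus `∫_{Q̃₁} ‖∇ₓβ̃‖² dz` is at most `Φ₅(K)`; `β̃ = betaTilde ψ V`,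
`∇ₓβ̃(t, x) = fderiv ℝ (β̃ t) x` (for the axially symmetric `β̃`, `|∇β̃| = |∇_a β̃|`),
`𝒞̃₁ = shell (5/16) (11/4) (7/4)`, `Q̃₁ = shellCyl (5/16) (11/4) (7/4) (7/4)`.
[cite: SereginZajaczkowski2007, proof of Lemma 4.3, (4.18)] -/
def SwirlL4EnergyBound : Prop :=
  ∀ ψ : ℝ × ℝ³ → ℝ, IsSwirlCutoff ψ →
    ∃ Φ₅ : ℝ≥0 → ℝ≥0, Monotone Φ₅ ∧
      ∀ (V : ℝ → ℝ³ → ℝ³) (P : ℝ → ℝ³ → ℝ),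
        IsSmoothAxisymmetricSolutionOn (shellCylOpens (1 / 4) 3 2 2) V P →
        ∀ K : ℝ≥0, szEnergy V P (fun t x => fderiv ℝ (V t) x) ≤ K →
          (⨆ t ∈ Ioo (-(7 / 4 : ℝ) ^ 2) 0,
              ∫⁻ x in shell (5 / 16) (11 / 4) (7 / 4), ‖betaTilde ψ V t x‖ₑ ^ 2) +
            ∫⁻ z in shellCyl (5 / 16) (11 / 4) (7 / 4) (7 / 4),
              ‖fderiv ℝ (betaTilde ψ V z.1) z.2‖ₑ ^ 2 ≤ Φ₅ K

/-! ### A cut-off of the printed kind exists -/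

/-- Time factor of the model cut-off: `0` for `t ≤ -11/4`, `1` for `t ≥ -9/4`. [folklore] -/
def cutT (t : ℝ) : ℝ :=
  Real.smoothTransition (2 * (t + 11 / 4))

/-- Radial factor of the model cut-off, as a function of `s = ϱ²`: `1` for `9/64 ≤ s ≤ 25/4`,
`0` for `s ≤ 1/8` and for `s ≥ 7`. [folklore] -/
def cutR (s : ℝ) : ℝ :=
  Real.smoothTransition (64 * (s - 1 / 8)) * Real.smoothTransition (4 / 3 * (7 - s))

/-- Axial factor of the model cut-off: `1` for `x₃² ≤ 9/4`, `0` for `x₃² ≥ 169/64`. [folklore] -/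
def cutZ (y : ℝ) : ℝ :=
  Real.smoothTransition (64 / 25 * (169 / 64 - y ^ 2))

/-- The model cut-off `ψ₀(t, x) = cutT t · cutR (x₀² + x₁²) · cutZ x₂`. [folklore] -/
def psi0 (z : ℝ × ℝ³) : ℝ :=
  cutT z.1 * (cutR (z.2 0 ^ 2 + z.2 1 ^ 2) * cutZ (z.2 2))

/-- The spatial support of `ψ₀`: `{1/8 ≤ ϱ² ≤ 7, x₃² ≤ 169/64}`. [folklore] -/
def psi0Support : Set ℝ³ :=
  {x | x 0 ^ 2 + x 1 ^ 2 ∈ Icc (1 / 8 : ℝ) 7 ∧ x 2 ^ 2 ≤ 169 / 64}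

/-- `cutT`, `cutR`, `cutZ` are smooth. [folklore] -/
theorem contDiff_cutT : ContDiff ℝ ∞ cutT :=
  Real.smoothTransition.contDiff.comp (contDiff_const.mul (contDiff_id.add contDiff_const))

/-- `cutR` is smooth. [folklore] -/
theorem contDiff_cutR : ContDiff ℝ ∞ cutR :=
  (Real.smoothTransition.contDiff.comp (contDiff_const.mul (contDiff_id.sub contDiff_const))).mul
    (Real.smoothTransition.contDiff.comp (contDiff_const.mul (contDiff_const.sub contDiff_id)))

/-- `cutZ` is smooth. [folklore] -/
theorem contDiff_cutZ : ContDiff ℝ ∞ cutZ :=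
  Real.smoothTransition.contDiff.comp
    (contDiff_const.mul (contDiff_const.sub (contDiff_id.pow 2)))

/-- `ψ₀` is smooth. [folklore] -/
theorem contDiff_psi0 : ContDiff ℝ ∞ psi0 := by
  have hp : ∀ i : Fin 3, ContDiff ℝ ∞ fun y : ℝ³ => y i := fun i =>
    (EuclideanSpace.proj i : ℝ³ →L[ℝ] ℝ).contDiff
  have h0 : ContDiff ℝ ∞ fun z : ℝ × ℝ³ => z.2 0 := (hp 0).comp contDiff_snd
  have h1 : ContDiff ℝ ∞ fun z : ℝ × ℝ³ => z.2 1 := (hp 1).comp contDiff_snd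
  have h2 : ContDiff ℝ ∞ fun z : ℝ × ℝ³ => z.2 2 := (hp 2).comp contDiff_snd
  unfold psi0
  exact (contDiff_cutT.comp contDiff_fst).mul
    ((contDiff_cutR.comp ((h0.pow 2).add (h1.pow 2))).mul (contDiff_cutZ.comp h2))

/-- The spatial support set of `ψ₀` is compact. [folklore] -/
theorem isCompact_psi0Support : IsCompact psi0Support := by
  have hc01 : Continuous fun x : ℝ³ => x 0 ^ 2 + x 1 ^ 2 := by fun_prop
  have hc2 : Continuous fun x : ℝ³ => x 2 ^ 2 := by fun_prop
  have hclosed : IsClosed psi0Support :=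
    (isClosed_Icc.preimage hc01).inter (isClosed_le hc2 continuous_const)
  refine Metric.isCompact_of_isClosed_isBounded hclosed ?_
  refine (Metric.isBounded_iff_subset_closedBall (0 : ℝ³)).2 ⟨4, fun x hx => ?_⟩
  rw [mem_closedBall, dist_zero_right, EuclideanSpace.norm_eq]
  simp only [Fin.sum_univ_three, Real.norm_eq_abs, sq_abs]
  obtain ⟨⟨-, h1⟩, h2⟩ := hx
  rw [show (4 : ℝ) = Real.sqrt 16 by rw [show (16 : ℝ) = 4 ^ 2 by norm_num,
    Real.sqrt_sq (by norm_num)]]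
  exact Real.sqrt_le_sqrt (by linarith)

/-- The spatial support set of `ψ₀` lies in the open shell `𝒞̃₁ = 𝒞(5/16, 11/4; 7/4)`. [folklore] -/
theorem psi0Support_subset : psi0Support ⊆ shell (5 / 16) (11 / 4) (7 / 4) := by
  intro x hx
  obtain ⟨⟨h1, h2⟩, h3⟩ := hx
  have hr := cylRadius_sq x
  have hr0 := cylRadius_nonneg x
  rw [mem_shell]
  refine ⟨⟨?_, ?_⟩, ?_⟩
  · nlinarith
  · nlinarith
  · exact abs_lt_of_sq_lt_sq (by nlinarith) (by norm_num)

/-- `ψ₀(t, x) = 0` for `x` outside its spatial support set. [folklore] -/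
theorem psi0_eq_zero_of_not_mem {t : ℝ} {x : ℝ³} (hx : x ∉ psi0Support) : psi0 (t, x) = 0 := by
  simp only [psi0Support, mem_setOf_eq, mem_Icc, not_and_or, not_le] at hx
  unfold psi0 cutR cutZ
  rcases hx with (h | h) | h
  · rw [Real.smoothTransition.zero_of_nonpos (x := 64 * (x 0 ^ 2 + x 1 ^ 2 - 1 / 8)) (by
      simp only at h ⊢; linarith)]
    simp
  · rw [Real.smoothTransition.zero_of_nonpos (x := 4 / 3 * (7 - (x 0 ^ 2 + x 1 ^ 2))) (by
      simp only at h ⊢; linarith)]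
    simp
  · rw [Real.smoothTransition.zero_of_nonpos (x := 64 / 25 * (169 / 64 - x 2 ^ 2)) (by
      simp only at h ⊢; linarith)]
    simp

/-- `ψ₀(t, ·) = 0` for `t ≤ -11/4`. [folklore] -/
theorem psi0_eq_zero_of_le {t : ℝ} (ht : t ≤ -11 / 4) (x : ℝ³) : psi0 (t, x) = 0 := by
  unfold psi0 cutT
  rw [Real.smoothTransition.zero_of_nonpos (by simp only; linarith)]
  simp

/-- `ψ₀ = 1` on `Q̃₂`. [folklore] -/
theorem psi0_eq_one {z : ℝ × ℝ³} (hz : z ∈ shellCyl (3 / 8) (5 / 2) (3 / 2) (3 / 2)) :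
    psi0 z = 1 := by
  rw [mem_shellCyl] at hz
  obtain ⟨⟨ht1, -⟩, ⟨hr1, hr2⟩, h3⟩ := hz
  have hr := cylRadius_sq z.2
  have hr0 := cylRadius_nonneg z.2
  have h3' : z.2 2 ^ 2 < 9 / 4 := by
    have := abs_lt.1 h3
    nlinarith
  unfold psi0 cutT cutR cutZ
  rw [Real.smoothTransition.one_of_one_le (by linarith),
    Real.smoothTransition.one_of_one_le (by nlinarith),
    Real.smoothTransition.one_of_one_le (by nlinarith),
    Real.smoothTransition.one_of_one_le (by nlinarith)]
  norm_num

/-- **The model cut-off is a cut-off of the printed kind** (non-vacuity of `IsSwirlCutoff`).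
[folklore] -/
theorem isSwirlCutoff_psi0 : IsSwirlCutoff psi0 where
  contDiff := contDiff_psi0
  nonneg z := by
    unfold psi0 cutT cutR cutZ
    exact mul_nonneg (Real.smoothTransition.nonneg _) (mul_nonneg
      (mul_nonneg (Real.smoothTransition.nonneg _) (Real.smoothTransition.nonneg _))
      (Real.smoothTransition.nonneg _))
  axisymmetric θ t x := by
    have h := cylRadius_rotZ θ x
    have h2 : (rotZ θ x) 0 ^ 2 + (rotZ θ x) 1 ^ 2 = x 0 ^ 2 + x 1 ^ 2 := by
      rw [← cylRadius_sq, ← cylRadius_sq, h]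
    simp only [psi0, rotZ_apply_two]
    rw [h2]
  eq_one z hz := psi0_eq_one hz
  space_support := ⟨psi0Support, isCompact_psi0Support, psi0Support_subset,
    fun _ _ hx => psi0_eq_zero_of_not_mem hx⟩
  time_support := ⟨-11 / 4, by norm_num, fun _ ht x => psi0_eq_zero_of_le ht x⟩

/-! ### The spatial derivatives of `Γ`, of the slices of `ψ`, and of `β̃` (explicit formulas) -/

section Derivatives

variable {ψ : ℝ × ℝ³ → ℝ}

/-- The derivative of `x ↦ swirl u x = x₀ u₁ - x₁ u₀` at `x`, in terms of `x`, `u x` and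
`D u (x)`. [folklore] -/
def swirlFDeriv (x v : ℝ³) (D : ℝ³ →L[ℝ] ℝ³) : ℝ³ →L[ℝ] ℝ :=
  (x 0 • (EuclideanSpace.proj (1 : Fin 3) : ℝ³ →L[ℝ] ℝ).comp D +
      v 1 • (EuclideanSpace.proj (0 : Fin 3) : ℝ³ →L[ℝ] ℝ)) -
    (x 1 • (EuclideanSpace.proj (0 : Fin 3) : ℝ³ →L[ℝ] ℝ).comp D +
      v 0 • (EuclideanSpace.proj (1 : Fin 3) : ℝ³ →L[ℝ] ℝ))

/-- Chain rule for the swirl `Γ = x₀ u₁ - x₁ u₀`. [folklore] -/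
theorem hasFDerivAt_swirl {u : ℝ³ → ℝ³} {x : ℝ³} {D : ℝ³ →L[ℝ] ℝ³} (hu : HasFDerivAt u D x) :
    HasFDerivAt (swirl u) (swirlFDeriv x (u x) D) x := by
  have h0 : HasFDerivAt (fun y : ℝ³ => y 0) (EuclideanSpace.proj (0 : Fin 3) : ℝ³ →L[ℝ] ℝ) x :=
    (EuclideanSpace.proj (0 : Fin 3) : ℝ³ →L[ℝ] ℝ).hasFDerivAt
  have h1 : HasFDerivAt (fun y : ℝ³ => y 1) (EuclideanSpace.proj (1 : Fin 3) : ℝ³ →L[ℝ] ℝ) x :=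
    (EuclideanSpace.proj (1 : Fin 3) : ℝ³ →L[ℝ] ℝ).hasFDerivAt
  have hu0 : HasFDerivAt (fun y : ℝ³ => u y 0)
      ((EuclideanSpace.proj (0 : Fin 3) : ℝ³ →L[ℝ] ℝ).comp D) x :=
    (EuclideanSpace.proj (0 : Fin 3) : ℝ³ →L[ℝ] ℝ).hasFDerivAt.comp x hu
  have hu1 : HasFDerivAt (fun y : ℝ³ => u y 1)
      ((EuclideanSpace.proj (1 : Fin 3) : ℝ³ →L[ℝ] ℝ).comp D) x :=
    (EuclideanSpace.proj (1 : Fin 3) : ℝ³ →L[ℝ] ℝ).hasFDerivAt.comp x hu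
  have h := (h0.mul hu1).sub (h1.mul hu0)
  exact h

/-- The continuity of `(x, v, D) ↦ swirlFDeriv x v D`. [folklore] -/
theorem continuous_swirlFDeriv :
    Continuous fun p : ℝ³ × ℝ³ × (ℝ³ →L[ℝ] ℝ³) => swirlFDeriv p.1 p.2.1 p.2.2 := by
  unfold swirlFDeriv
  have hp : ∀ i : Fin 3, Continuous fun y : ℝ³ => y i := fun i =>
    (EuclideanSpace.proj i : ℝ³ →L[ℝ] ℝ).continuous
  refine ((((hp 0).comp continuous_fst).smul
    (continuous_const.clm_comp continuous_snd.snd)).add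
    (((hp 1).comp continuous_snd.fst).smul continuous_const)).sub
    ((((hp 1).comp continuous_fst).smul
    (continuous_const.clm_comp continuous_snd.snd)).add
    (((hp 0).comp continuous_snd.fst).smul continuous_const))

/-- The spatial derivative of the slice `x ↦ ψ(t, x)`. [folklore] -/
def sliceFDeriv (ψ : ℝ × ℝ³ → ℝ) (z : ℝ × ℝ³) : ℝ³ →L[ℝ] ℝ :=
  (fderiv ℝ ψ z).comp (ContinuousLinearMap.inr ℝ ℝ ℝ³)

/-- Chain rule for the slice `x ↦ ψ(t, x)` of a `C¹` function. [folklore] -/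
theorem hasFDerivAt_slice (hψ : ContDiff ℝ ∞ ψ) (t : ℝ) (x : ℝ³) :
    HasFDerivAt (fun y => ψ (t, y)) (sliceFDeriv ψ (t, x)) x :=
  ((hψ.differentiable (by simp)) (t, x)).hasFDerivAt.comp x (hasFDerivAt_prodMk_right t x)

/-- The explicit spatial derivative of `β̃(t, ·) = (ψ(t, ·) Γ(V t))²`. [folklore] -/
def betaTildeFDeriv (ψ : ℝ × ℝ³ → ℝ) (V : ℝ → ℝ³ → ℝ³) (z : ℝ × ℝ³) : ℝ³ →L[ℝ] ℝ :=
  (2 * alphaTilde ψ V z.1 z.2) •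
    (ψ z • swirlFDeriv z.2 (V z.1 z.2) (fderiv ℝ (V z.1) z.2) +
      swirl (V z.1) z.2 • sliceFDeriv ψ z)

end Derivatives

end SereginZajaczkowski2007

end Literature.Analysis.FluidPDE
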